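import Summits.Ventures.PercRepro.ExcessOneCompletionFlip

/-!
# The steps of Theorem W: the top member, the empty member, and the complementary pair

Third module of Theorem W (proofs/MINE1-theoremS.md, Addendum 12). Throughout, `G` is a tight
family with addable part `M = Rstar G`, `Φ = flip M G = G \\ G`, and `u` is a twin-closed set
with `u, uᶜ ∉ G` such that every member other than a distinguished member `v` is A- or
C*-signable for `u` (its two agreement cells or its two disagreement cells lie in `Φ`).

* `Rstar_eq_of_cells`: the top member `M` is unsignable, so `v = M` — this is (TL) evaluated at
  `Rstar G` (`mem_or_compl_mem_of_dichotomy`) in the form needed here.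
* `Rstar_notMem_flip`: if `M ≠ ∅` then `∅ ∉ G`, i.e. `M ∉ Φ`.
* `cls_mem_flip_of_notMem_Rstar`, `cls_mem_flip_of_mem_Rstar`: the twin class of an element
  outside `M` (inside `M`) is a flipped member, given full support (empty core).
* `pair_false`: once `(univ \ M) \ x ∈ Φ` and `M \ y ∈ Φ` for a flipped `x ∉ M`-class and a
  flipped `y ⊆ M`, the members `x ∪ (M \ y)` and its complement form a complementary pair of
  members other than `v = M` — impossible when `G \ {v}` has no complementary pair.
-/

namespace PercRepro.MSTight

open Finset
open scoped FinsetFamily symmDiff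

variable {α : Type*} [DecidableEq α] [Fintype α]

variable {G : Finset (Finset α)} {M : Finset α}

/-- **The top member is the exception.** If every member other than `v` is signable for a
twin-closed `u` with `u, uᶜ ∉ G`, then `v = Rstar G`. -/
theorem Rstar_eq_of_cells (hT : Tight G) (hM : M = Rstar G) {u v : Finset α}
    (hutc : TwinClosed G u) (hv : v ∈ G) (hu : u ∉ G) (huc : Finset.univ \ u ∉ G)
    (hsign : ∀ t ∈ G, t ≠ v → Cells (G \\ G) t u ∨ Cells (G \\ G) t (Finset.univ \ u)) :
    v = M := by
  have hG := dichotomy_of_tight hT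
  have hMG : M ∈ G := hM ▸ Rstar_mem_of_dichotomy hG ⟨v, hv⟩
  have hMG' : (∅ : Finset α) ∪ M ∈ G := by
    rw [Finset.empty_union]
    exact hMG
  by_contra hne
  have hne' : (∅ : Finset α) ∪ M ≠ v := by
    rw [Finset.empty_union]
    exact Ne.symm hne
  rcases hsign _ hMG' hne' with hA | hC
  · rw [cellsA_union_iff hT hM hutc hMG', Finset.sdiff_empty] at hA
    exact huc (compl_mem_of_flags hT hM hutc hA.2 hA.1)
  · rw [cellsC_union_iff hT hM hutc hMG', Finset.sdiff_empty] at hC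
    exact hu (mem_of_flags hT hM hutc hC.2 hC.1)

/-- **The empty set is not a member** unless `M = ∅`: with `v = M ≠ ∅`, the member `∅` would be
signable, which forces `u ∈ G` or `uᶜ ∈ G`. Stated as `M ∉ Φ` (`∅ ∈ G ↔ M ∈ Φ`). -/
theorem Rstar_notMem_flip (hT : Tight G) (hM : M = Rstar G) {u : Finset α}
    (hutc : TwinClosed G u) (hu : u ∉ G) (huc : Finset.univ \ u ∉ G) (hM0 : M ≠ ∅)
    (hsign : ∀ t ∈ G, t ≠ M → Cells (G \\ G) t u ∨ Cells (G \\ G) t (Finset.univ \ u)) :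
    M ∉ flip M G := by
  intro hMΦ
  have hMtc : TwinClosed G M := hM ▸ twinClosed_Rstar G
  have h0G : M \ M ∈ G := Rstar_sdiff_mem hM hMΦ subset_rfl
  have hδ : M \ u ∈ flip M G := mem_flip_of_subset hT hM hMΦ sdiff_subset (hMtc.sdiff hutc)
  have hγ : u ∩ M ∈ flip M G :=
    mem_flip_of_subset hT hM hMΦ inter_subset_right (hutc.inter hMtc)
  have h0ne : M \ M ≠ M := by
    rw [Finset.sdiff_self]
    exact Ne.symm hM0
  rcases hsign _ h0G h0ne with hA | hC
  · rw [cellsA_sdiff_iff hT hM hutc h0G] at hA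
    exact huc (compl_mem_of_flags hT hM hutc hA.2 hγ)
  · rw [cellsC_sdiff_iff hT hM hutc h0G] at hC
    exact hu (mem_of_flags hT hM hutc hC.2 hδ)

/-- With full support, the twin class of an element outside the addable part is a flipped
member. -/
theorem cls_mem_flip_of_notMem_Rstar (hT : Tight G) (hM : M = Rstar G)
    (hsupp : ∀ a : α, ∃ t ∈ G, a ∈ t) {n : α} (hn : n ∉ M) : cls G n ∈ flip M G := by
  have hMtc : TwinClosed G M := hM ▸ twinClosed_Rstar G
  obtain ⟨t, ht, hnt⟩ := hsupp n
  refine mem_flip_of_subset hT hM (sdiff_Rstar_mem_flip hT hM ht) ?_ (twinClosed_cls G n)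
  intro a ha
  rw [mem_sdiff]
  exact ⟨cls_subset_of_mem ht hnt ha,
    Finset.disjoint_left.1 (disjoint_cls_of_twinClosed_of_notMem hMtc hn) ha⟩

/-- With empty core, the twin class of an element of the addable part is a flipped member. -/
theorem cls_mem_flip_of_mem_Rstar (hT : Tight G) (hM : M = Rstar G)
    (hcore : ∀ a : α, ∃ t ∈ G, a ∉ t) {m : α} (hm : m ∈ M) : cls G m ∈ flip M G := by
  have hMtc : TwinClosed G M := hM ▸ twinClosed_Rstar G
  obtain ⟨t, ht, hmt⟩ := hcore m
  refine mem_flip_of_subset hT hM (Rstar_sdiff_mem_flip hT hM ht) ?_ (twinClosed_cls G m)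
  intro a ha
  rw [mem_sdiff]
  exact ⟨cls_subset_of_twinClosed hMtc hm ha,
    Finset.disjoint_left.1 (disjoint_cls_of_notMem ht hmt) ha⟩

/-- **The complementary pair.** Let `x ∈ Φ` be twin-closed and disjoint from `M` with some
`n ∈ x`, and `y ∈ Φ` twin-closed inside `M`. If `(univ \ M) \ x ∈ Φ` and `M \ y ∈ Φ`, then
`x ∪ (M \ y)` and its complement are members, neither equal to `M` unless `M = y ∈ Φ`; so if
`M ∉ Φ` and the members other than `M` contain no complementary pair, this is impossible. -/
theorem pair_false (hT : Tight G) (hM : M = Rstar G)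
    (hval : ∀ t ∈ G, t ≠ M → Finset.univ \ t ∈ G → Finset.univ \ t = M) (hMΦ : M ∉ flip M G)
    {x y : Finset α} (hxtc : TwinClosed G x) (hytc : TwinClosed G y) (hxΦ : x ∈ flip M G)
    (hyΦ : y ∈ flip M G) (hxM : Disjoint x M) (hyM : y ⊆ M) {n : α} (hnx : n ∈ x)
    (hN : (Finset.univ \ M) \ x ∈ flip M G) (hMy : M \ y ∈ flip M G) : False := by
  have hMtc : TwinClosed G M := hM ▸ twinClosed_Rstar G
  have hn : n ∉ M := Finset.disjoint_left.1 hxM hnx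
  have hg1 : x ∪ (M \ y) ∈ G := by
    refine mem_of_parts hT hM (hxtc.union (hMtc.sdiff hytc)) ?_ ?_
    · rw [idW_pair_sdiff hxM]
      exact hxΦ
    · rw [idW_pair_sdiff' hxM hyM]
      exact hyΦ
  have hg1_ne : x ∪ (M \ y) ≠ M := by
    intro h
    apply hn
    rw [← h]
    exact mem_union_left _ hnx
  have hg2 : Finset.univ \ (x ∪ (M \ y)) ∈ G := by
    refine mem_of_parts hT hM ((twinClosed_univ G).sdiff (hxtc.union (hMtc.sdiff hytc))) ?_ ?_
    · rw [idW_pair_compl_sdiff]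
      exact hN
    · rw [idW_pair_compl_sdiff' hxM]
      exact hMy
  have hcompl := hval _ hg1 hg1_ne hg2
  have hMeq : M = y := Subset.antisymm (idW_pair_compl_subset hcompl) hyM
  apply hMΦ
  have h' : y ∈ flip M G := hyΦ
  rwa [← hMeq] at h'

end PercRepro.MSTight
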